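import Summits.CriticalPhenomena.SAWScalingLimit.Theorems.SAWLeftRightFKGFKGToTraversalBoundOutlineAbab
import HarnessLib

/-!
# One-sidedness of the contacts of the free component with a far piece (witness unit U5a)

Crux `SAWLeftRightFKG.FKGToTraversalBound` (stmt-CriticalPhenomena-1878), line `slit-necklace`, lead
prover-line-stmt-CriticalPhenomena-1878-c5-0; witness unit U5 (cyclic monotonicity of a far piece's contacts
along the wall-follower tour), sub-unit U5a, on top of `…SlitNecklaceOutline` (`ODir`) and `…OutlineFaces`
(`cornerFace`, `sepEdge_cornerFace`: the four faces around a lattice site `x` are `cornerFace (x, e)`).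

Registered stub `obstacle_oneSided`: `A ⊆ ℤ²` is `4`-connected, `r` a lattice PATH (the obstacle), `J` a CLOSED
lattice walk off `A` using every edge of `r` exactly once and no other edge at the interior vertices `r_m` of `r`.
A contact configuration `(f, d, m)` (`f ∈ A`, `0 < m < |r|`, `r_m = f + vec d`; `t = vec (ccw d)`) is of LEFT
type when `r_{m+1} = r_m + t` or `r_{m-1} = r_m - t`, of RIGHT type when `r_{m+1} = r_m - t` or
`r_{m-1} = r_m + t`.  Claim: all configurations are of left type, or all are of right type.

Proof (discrete planar topology by the tree's combinatorial winding number `walkWinding`, no Jordan curve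
theorem).  JUMP (`oneSided_jump`): across an edge used exactly ONCE by `J` the winding number changes (the tree's
`walkWinding_sub_eq_of_vertical_mem` / `…horizontal_mem` with `edges.Nodup` weakened to multiplicity one), and it
does not change across an unused edge (`walkWinding_closed_eq_of_adj`).  LOCAL CHAIN (`oneSided_local`): at an
interior vertex `x = r_m` the only `J`-edges are the two `r`-edges, so around `x` the faces left of the route
carry one value and the faces right of it another (a finite check on `Fin 4`).  GLOBAL CHAIN (`oneSided_chain`):
by induction along `r`, one value `wL` on all left faces of `r`-edges and one value `wR ≠ wL` on all right faces.
CONTACTS (`oneSided_contact`): the faces at `f ∈ A` carry the value at `f` (`walkWinding_eq_of_mem_corners`),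
independent of `f` (`walkWinding_eq_of_walk_closed` along an `A`-walk); at a contact the two faces of `{f, r_m}`
are faces around `r_m`, a left-type configuration makes one of them a left face of an `r`-edge (value `wL`), a
right-type one a right face (value `wR`), and every configuration has one of the two types.  So left-type and
right-type configurations cannot coexist.

All statements folklore (discrete winding numbers, Kesten, *Percolation theory for mathematicians* (1982), §2.2,
already formalised in `PlanarDuality.lean` / `RandomClusterBoxDuality.lean` / `SquareTilingConjugate.lean`); no
literature fact is introduced; nothing restates the crux.
-/

noncomputable section

open Literature.Probability.LatticeModels Literature.Probability.Percolation
open Literature.Probability.LatticeModels.SquareTiling (corners mem_corners_iff walkWinding_eq_of_walk_closed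
  walkWinding_eq_of_mem_corners)

namespace Summit.CriticalPhenomena.SAWScalingLimit.Theorems.FKGToTraversalBound.SlitNecklace

/-! ### Directions and the four faces around a site -/

/-- The unit vectors of distinct directions are distinct. [folklore] -/
private theorem oneSided_vec_injective {d d' : ODir} (h : d.vec = d'.vec) : d = d' := by
  have h0 := congrFun h 0
  have h1 := congrFun h 1
  fin_cases d <;> fin_cases d' <;> first | rfl | (exfalso; revert h0 h1; simp [ODir.vec])

/-- A lattice step moves: `x + vec d ≠ x`. [folklore] -/
private theorem oneSided_add_vec_ne (x : Site 2) (d : ODir) : x + d.vec ≠ x := by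
  intro h
  have h' : d.vec = 0 := add_left_cancel (h.trans (add_zero x).symm)
  have h0 := congrFun h' 0
  have h1 := congrFun h' 1
  fin_cases d <;> simp [ODir.vec] at h0 h1

/-- Two left quarter turns make a half turn. [folklore] -/
private theorem oneSided_ccw_ccw (d : ODir) : d.ccw.ccw = d.rev := by
  fin_cases d <;> rfl

/-- A half turn followed by a left quarter turn is a right quarter turn. [folklore] -/
private theorem oneSided_rev_ccw (d : ODir) : d.rev.ccw = d.cw := by
  fin_cases d <;> rfl

/-- Three pairwise constraints on the directions at a contact leave only the four left/right cases. [folklore] -/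
private theorem oneSided_dirs : ∀ a b c : ODir, a ≠ b → a ≠ c.rev → b ≠ c.rev →
    (b = c.ccw ∨ a = c.cw) ∨ (b = c.cw ∨ a = c.ccw) := by
  decide

/-- The four faces around a site `x` are `cornerFace (x, e)`; turning the direction left moves to the next face
counter-clockwise, across the lattice edge `{x, x + vec e}`. [folklore] -/
private theorem oneSided_cornerFace_ccw (x : Site 2) (e : ODir) :
    cornerFace (x, e.ccw) = cornerFace (x, e) + e.ccw.vec := by
  simp only [cornerFace_mk, ODir.foff_ccw, add_assoc]

/-- The LEFT face of the lattice edge from `y` in direction `d`, seen from its far endpoint. [folklore] -/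
private theorem oneSided_cornerFace_rev (y : Site 2) (d : ODir) :
    cornerFace (y + d.vec, d.rev) = cornerFace (y, d) + d.ccw.vec := by
  simp only [cornerFace_mk]
  ext i
  fin_cases d <;> fin_cases i <;> simp [ODir.foff, ODir.ccw, ODir.rev, ODir.vec]

/-- The RIGHT face of the lattice edge from `y` in direction `d`, seen from its far endpoint. [folklore] -/
private theorem oneSided_cornerFace_cw (y : Site 2) (d : ODir) :
    cornerFace (y + d.vec, d.cw) = cornerFace (y, d) := by
  simp only [cornerFace_mk]
  ext i
  fin_cases d <;> fin_cases i <;> simp [ODir.foff, ODir.cw, ODir.vec]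

/-- A function on the four directions whose only possible jumps are at `a` and `b ≠ a` takes equal values at
`a`, `ccw b` and at `ccw a`, `b`. [folklore] -/
private theorem oneSided_fin4 (w : ODir → ℤ) (a b : ODir) (hab : a ≠ b)
    (h : ∀ e : ODir, e ≠ a → e ≠ b → w e = w e.ccw) : w a = w b.ccw ∧ w a.ccw = w b := by
  have h0 := h 0; have h1 := h 1; have h2 := h 2; have h3 := h 3
  fin_cases a <;> fin_cases b <;> simp (config := { decide := true }) [ODir.ccw] at hab h0 h1 h2 h3 ⊢ <;> omega

/-! ### Winding numbers: the jump across an edge used exactly once -/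

/-- If the edge `E` occurs exactly once among the edges of a walk, a dart sum of a function vanishing on the
darts off `E` reduces to its value at the unique dart through `E`. [folklore] -/
private theorem oneSided_sum_darts {a b : Site 2} (p : (zdGraph 2).Walk a b) {E : Sym2 (Site 2)}
    (h : p.edges.count E = 1) (g : (zdGraph 2).Dart → ℤ) (hg : ∀ d, d.edge ≠ E → g d = 0) :
    ∃ d : (zdGraph 2).Dart, d.edge = E ∧ (p.darts.map g).sum = g d := by
  have hmem : E ∈ p.edges := List.count_pos_iff.1 (by omega)
  rw [SimpleGraph.Walk.edges] at hmem h
  obtain ⟨d, hd, hde⟩ := List.mem_map.1 hmem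
  obtain ⟨l₁, l₂, hl⟩ := List.append_of_mem hd
  rw [hl, List.map_append, List.map_cons, hde, List.count_append, List.count_cons_self] at h
  have hz : ∀ d' ∈ l₁ ++ l₂, g d' = 0 := by
    intro d' hd'
    refine hg d' fun heq => ?_
    rcases List.mem_append.1 hd' with h1 | h2
    · have := List.count_pos_iff.2 (List.mem_map.2 ⟨d', h1, heq⟩); omega
    · have := List.count_pos_iff.2 (List.mem_map.2 ⟨d', h2, heq⟩); omega
  have h1 : (l₁.map g).sum = 0 := List.sum_eq_zero fun t ht => by
    obtain ⟨d', hd', rfl⟩ := List.mem_map.1 ht; exact hz d' (List.mem_append_left _ hd')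
  have h2 : (l₂.map g).sum = 0 := List.sum_eq_zero fun t ht => by
    obtain ⟨d', hd', rfl⟩ := List.mem_map.1 ht; exact hz d' (List.mem_append_right _ hd')
  refine ⟨d, hde, ?_⟩
  rw [hl, List.map_append, List.map_cons, List.sum_append, List.sum_cons, h1, h2, zero_add, add_zero]

/-- Across a vertical edge used exactly once by a closed lattice walk, the winding number jumps by `±1`
(`walkWinding_sub_eq_of_vertical_mem` with `edges.Nodup` weakened to multiplicity one). [folklore] -/
private theorem oneSided_sub_eq_of_vertical_count {a : Site 2} {p : (zdGraph 2).Walk a a} {u : Site 2}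
    (h : p.edges.count s(u + Pi.single 0 1, u + Pi.single 0 1 + Pi.single 1 1) = 1) :
    walkWinding p u - walkWinding p (u + Pi.single 0 1) = 1 ∨
      walkWinding p u - walkWinding p (u + Pi.single 0 1) = -1 := by
  rw [walkWinding_sub_walkWinding_right]
  obtain ⟨d, hde, hsum⟩ :=
    oneSided_sum_darts p h (fun d => vCross u d.fst d.snd) fun d hd => vCross_eq_zero_of_ne hd
  rw [hsum]
  have hd2 : s(d.fst, d.snd) = s(u + Pi.single 0 1, u + Pi.single 0 1 + Pi.single 1 1) := hde
  rcases Sym2.eq_iff.1 hd2 with ⟨h1, h2⟩ | ⟨h1, h2⟩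
  · left; unfold vCross; rw [if_pos, if_neg] <;> simp [h1, h2]
  · right; unfold vCross; rw [if_neg, if_pos] <;> simp [h1, h2]

/-- Across a horizontal edge used exactly once by a closed lattice walk, the winding number jumps by `±1`.
[folklore] -/
private theorem oneSided_sub_eq_of_horizontal_count {a : Site 2} {p : (zdGraph 2).Walk a a} {u : Site 2}
    (h : p.edges.count s(u + Pi.single 1 1, u + Pi.single 1 1 + Pi.single 0 1) = 1) :
    walkWinding p u - walkWinding p (u + Pi.single 1 1) = 1 ∨
      walkWinding p u - walkWinding p (u + Pi.single 1 1) = -1 := by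
  have hsub := walkWinding_sub_walkWinding_up p u
  rw [sub_self, neg_zero, zero_sub] at hsub
  obtain ⟨d, hde, hsum⟩ :=
    oneSided_sum_darts p h (fun d => hCross u d.fst d.snd) fun d hd => hCross_eq_zero_of_ne hd
  rw [hsub, hsum]
  have hd2 : s(d.fst, d.snd) = s(u + Pi.single 1 1, u + Pi.single 1 1 + Pi.single 0 1) := hde
  rcases Sym2.eq_iff.1 hd2 with ⟨h1, h2⟩ | ⟨h1, h2⟩
  · right; unfold hCross; rw [if_pos, if_neg] <;> simp [h1, h2]
  · left; unfold hCross; rw [if_neg, if_pos] <;> simp [h1, h2]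

/-- **A closed lattice walk winds differently about the two faces of an edge it uses exactly once.**
[folklore] -/
private theorem oneSided_walkWinding_ne_of_count {a : Site 2} {p : (zdGraph 2).Walk a a} {z z' : Site 2}
    (hzz : (zdGraph 2).Adj z z') (h : p.edges.count (sepEdge z z') = 1) :
    walkWinding p z ≠ walkWinding p z' := by
  rcases stepKind_of_adj hzz with ⟨h0, h1⟩ | ⟨h0, h1⟩ | ⟨h1, h0⟩ | ⟨h1, h0⟩
  · obtain rfl : z' = z + Pi.single 0 1 := by simp [Site.eq_iff_two, h0, h1]
    rw [sepEdge_right] at h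
    rcases oneSided_sub_eq_of_vertical_count h with h' | h' <;> omega
  · obtain rfl : z = z' + Pi.single 0 1 := by simp [Site.eq_iff_two, h0, h1]
    rw [sepEdge_comm, sepEdge_right] at h
    rcases oneSided_sub_eq_of_vertical_count h with h' | h' <;> omega
  · obtain rfl : z' = z + Pi.single 1 1 := by simp [Site.eq_iff_two, h0, h1]
    rw [sepEdge_up] at h
    rcases oneSided_sub_eq_of_horizontal_count h with h' | h' <;> omega
  · obtain rfl : z = z' + Pi.single 1 1 := by simp [Site.eq_iff_two, h0, h1]
    rw [sepEdge_comm, sepEdge_up] at h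
    rcases oneSided_sub_eq_of_horizontal_count h with h' | h' <;> omega

/-- The jump across the lattice edge `{x, x + vec e}` used exactly once, between the consecutive faces
`cornerFace (x, e)` and `cornerFace (x, ccw e)` around `x`. [folklore] -/
private theorem oneSided_jump {a : Site 2} {p : (zdGraph 2).Walk a a} (x : Site 2) (e : ODir)
    (h : p.edges.count s(x, x + e.vec) = 1) :
    walkWinding p (cornerFace (x, e)) ≠ walkWinding p (cornerFace (x, e.ccw)) := by
  rw [oneSided_cornerFace_ccw]
  refine oneSided_walkWinding_ne_of_count (ODir.adj_add_vec _ _) ?_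
  rw [sepEdge_cornerFace]
  exact h

/-- No jump across a lattice edge `{x, x + vec e}` not used by the closed walk. [folklore] -/
private theorem oneSided_flat {a : Site 2} {p : (zdGraph 2).Walk a a} (x : Site 2) (e : ODir)
    (h : s(x, x + e.vec) ∉ p.edges) :
    walkWinding p (cornerFace (x, e)) = walkWinding p (cornerFace (x, e.ccw)) := by
  rw [oneSided_cornerFace_ccw]
  refine walkWinding_closed_eq_of_adj (ODir.adj_add_vec _ _) ?_
  rw [sepEdge_cornerFace]
  exact h

/-- **Local chain at a site.**  If the only edges of the closed walk `p` at the site `x` are `{x + vec a, x}`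
and `{x, x + vec b}` (`a ≠ b`), then `p` winds equally about the faces `cornerFace (x, a)`,
`cornerFace (x, ccw b)` (the faces LEFT of the route `x + vec a → x → x + vec b`) and equally about
`cornerFace (x, ccw a)`, `cornerFace (x, b)` (the faces RIGHT of it). [folklore] -/
private theorem oneSided_local {a₀ : Site 2} {p : (zdGraph 2).Walk a₀ a₀} (x : Site 2) {a b : ODir}
    (hab : a ≠ b) (hJ : ∀ e ∈ p.edges, x ∈ e → e = s(x + a.vec, x) ∨ e = s(x, x + b.vec)) :
    walkWinding p (cornerFace (x, a)) = walkWinding p (cornerFace (x, b.ccw)) ∧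
      walkWinding p (cornerFace (x, a.ccw)) = walkWinding p (cornerFace (x, b)) := by
  refine oneSided_fin4 (fun e => walkWinding p (cornerFace (x, e))) a b hab fun e hea heb => ?_
  refine oneSided_flat x e fun hmem => ?_
  rcases hJ _ hmem (Sym2.mem_mk_left _ _) with h | h
  · rcases Sym2.eq_iff.1 h with ⟨h1, -⟩ | ⟨-, h2⟩
    · exact oneSided_add_vec_ne x a h1.symm
    · exact hea (oneSided_vec_injective (add_left_cancel h2))
  · rcases Sym2.eq_iff.1 h with ⟨-, h2⟩ | ⟨h1, -⟩
    · exact heb (oneSided_vec_injective (add_left_cancel h2))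
    · exact oneSided_add_vec_ne x b h1.symm

/-! ### The chain of left and right faces along the obstacle path -/

/-- **Global chain.**  Let `r` be a lattice path and `J` a closed lattice walk whose only edges at each interior
vertex `r_m` of `r` are the two `r`-edges there.  Writing the `k`-th edge of `r` as `r_{k+1} = r_k + vec b`,
its RIGHT face is `cornerFace (r_k, b)` and its LEFT face is `cornerFace (r_k, ccw b)`; the winding number of
`J` about the left faces is the same for all edges of `r`, and likewise for the right faces. [folklore] -/
private theorem oneSided_chain {u v : Site 2} (r : (zdGraph 2).Walk u v) (J : (zdGraph 2).Walk u u)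
    (hr : r.IsPath)
    (hJr : ∀ m, 0 < m → m < r.length → ∀ e ∈ J.edges, r.getVert m ∈ e →
      e = s(r.getVert (m - 1), r.getVert m) ∨ e = s(r.getVert m, r.getVert (m + 1)))
    {d₀ : ODir} (hd₀ : r.getVert 1 = r.getVert 0 + d₀.vec) :
    ∀ k, k < r.length → ∀ b : ODir, r.getVert (k + 1) = r.getVert k + b.vec →
      walkWinding J (cornerFace (r.getVert k, b.ccw)) = walkWinding J (cornerFace (r.getVert 0, d₀.ccw)) ∧
        walkWinding J (cornerFace (r.getVert k, b)) = walkWinding J (cornerFace (r.getVert 0, d₀)) := by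
  intro k
  induction k with
  | zero =>
    intro _ b hb
    obtain rfl : b = d₀ := oneSided_vec_injective (add_left_cancel (hb.symm.trans hd₀))
    exact ⟨rfl, rfl⟩
  | succ k ih =>
    intro hk b' hb'
    have hk' : k < r.length := Nat.lt_of_succ_lt hk
    obtain ⟨b, hb⟩ := ODir.exists_eq_add_vec_of_adj (r.adj_getVert_succ hk')
    obtain ⟨ihL, ihR⟩ := ih hk' b hb
    have hprev : r.getVert k = r.getVert (k + 1) + b.rev.vec := by
      rw [hb, ODir.vec_rev, add_neg_cancel_right]
    -- no backtracking: `r` is a path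
    have hab : b.rev ≠ b' := by
      intro h
      have h2 : r.getVert (k + 1 + 1) = r.getVert k := by
        rw [hb', ← h]
        exact hprev.symm
      have := hr.getVert_injOn (by simp only [Set.mem_setOf_eq]; omega)
        (by simp only [Set.mem_setOf_eq]; omega) h2
      omega
    -- the local chain at `r_{k+1}`
    obtain ⟨h1, h2⟩ := oneSided_local (p := J) (r.getVert (k + 1)) hab fun e he hxe => by
      have := hJr (k + 1) k.succ_pos hk e he hxe
      rwa [Nat.add_sub_cancel, hprev, hb'] at this
    have e1 : cornerFace (r.getVert (k + 1), b.rev) = cornerFace (r.getVert k, b.ccw) := by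
      rw [hb, oneSided_cornerFace_rev, oneSided_cornerFace_ccw]
    have e2 : cornerFace (r.getVert (k + 1), b.rev.ccw) = cornerFace (r.getVert k, b) := by
      rw [hb, oneSided_rev_ccw, oneSided_cornerFace_cw]
    rw [e1, ihL] at h1
    rw [e2, ihR] at h2
    exact ⟨h1.symm, h2.symm⟩

/-! ### One contact -/

/-- **One contact.**  A closed lattice walk `J`, a site `f` off `J` and its neighbour `x = f + vec d`, whose
neighbours `yp = x + vec a`, `yn = x + vec b` (`a ≠ b`, both `≠ f`) carry the only `J`-edges at `x`; let `wL`,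
`wR` be the winding numbers of `J` about the left and right faces of the step `x → yn`.  Then the configuration
is of LEFT type (`yn = x + t` or `yp = x - t`, `t = vec (ccw d)`) or of RIGHT type (`yn = x - t` or
`yp = x + t`); in the left case `J` winds `wL` about the faces at `f`, in the right case `wR`. [folklore] -/
private theorem oneSided_contact {a₀ : Site 2} {J : (zdGraph 2).Walk a₀ a₀} {f x yp yn : Site 2}
    {d a b : ODir} {wL wR : ℤ} (hfJ : f ∉ J.support) (hx : x = f + d.vec) (ha : yp = x + a.vec)
    (hb : yn = x + b.vec) (hab : a ≠ b) (hpf : yp ≠ f) (hnf : yn ≠ f)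
    (hJ : ∀ e ∈ J.edges, x ∈ e → e = s(yp, x) ∨ e = s(x, yn))
    (hwL : walkWinding J (cornerFace (x, b.ccw)) = wL) (hwR : walkWinding J (cornerFace (x, b)) = wR) :
    ((yn = x + d.ccw.vec ∨ yp = x - d.ccw.vec) ∨ (yn = x - d.ccw.vec ∨ yp = x + d.ccw.vec)) ∧
      ((yn = x + d.ccw.vec ∨ yp = x - d.ccw.vec) → walkWinding J (f - 1) = wL) ∧
      ((yn = x - d.ccw.vec ∨ yp = x + d.ccw.vec) → walkWinding J (f - 1) = wR) := by
  subst ha hb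
  -- the two faces of the edge `{f, x}` are faces at `f`
  have hA1 : walkWinding J (cornerFace (x, d.cw)) = walkWinding J (f - 1) := by
    have h1 := walkWinding_eq_of_mem_corners J hfJ (cornerFace_add_one_mem_corners f d)
    rwa [add_sub_cancel_right, ← oneSided_cornerFace_cw f d, ← hx] at h1
  have hA2 : walkWinding J (cornerFace (x, d.rev)) = walkWinding J (f - 1) := by
    have h2 := walkWinding_eq_of_mem_corners J hfJ (cornerFace_end_add_one_mem_corners f d)
    rwa [add_sub_cancel_right, ← oneSided_cornerFace_rev f d, ← hx] at h2
  -- the neighbours on `r` are not `f`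
  have hf' : f = x + d.rev.vec := by rw [hx, ODir.vec_rev, add_neg_cancel_right]
  have hac : a ≠ d.rev := fun h => hpf (by rw [h, ← hf'])
  have hbc : b ≠ d.rev := fun h => hnf (by rw [h, ← hf'])
  have hcw : x - d.ccw.vec = x + d.cw.vec := by rw [ODir.vec_cw, sub_eq_add_neg]
  -- the local chain at `x`
  obtain ⟨hl1, hl2⟩ := oneSided_local (p := J) x hab hJ
  refine ⟨?_, ?_, ?_⟩
  · rcases oneSided_dirs a b d hab hac hbc with (rfl | rfl) | (rfl | rfl)
    · exact Or.inl (Or.inl rfl)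
    · exact Or.inl (Or.inr hcw.symm)
    · exact Or.inr (Or.inl hcw.symm)
    · exact Or.inr (Or.inr rfl)
  · rintro (h | h)
    · obtain rfl : b = d.ccw := oneSided_vec_injective (add_left_cancel h)
      rw [oneSided_ccw_ccw] at hwL
      exact hA2.symm.trans hwL
    · rw [hcw] at h
      obtain rfl : a = d.cw := oneSided_vec_injective (add_left_cancel h)
      exact hA1.symm.trans (hl1.trans hwL)
  · rintro (h | h)
    · rw [hcw] at h
      obtain rfl : b = d.cw := oneSided_vec_injective (add_left_cancel h)
      exact hA1.symm.trans hwR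
    · obtain rfl : a = d.ccw := oneSided_vec_injective (add_left_cancel h)
      rw [oneSided_ccw_ccw] at hl2
      exact hA2.symm.trans (hl2.trans hwR)

/-- The face `q` is a face around the site `q`. [folklore] -/
private theorem oneSided_add_one_mem_corners (q : Site 2) : q + 1 ∈ corners q := by
  rw [mem_corners_iff]
  simp

/-! ### The registered stub -/

/-- **Registered stub (witness unit U5a): one-sidedness of the contacts of the free component with a far
piece.**  `A` is `4`-connected, `J` a closed lattice walk off `A` using every edge of the path `r` exactly once and
no other edge at the interior vertices of `r`.  Then every contact `r_m = f + vec d` (`f ∈ A`, `0 < m < |r|`) is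
of LEFT type, or every contact is of RIGHT type.  Proof: `walkWinding J` takes one value `wL` on the left faces
of the edges of `r` and one value `wR ≠ wL` on the right faces (`oneSided_chain`, `oneSided_jump`), and one
value on all faces at sites of `A` (`walkWinding_eq_of_walk_closed`); a left-type contact forces the `A`-value
to be `wL`, a right-type contact forces `wR` (`oneSided_contact`). [folklore] -/
theorem obstacle_oneSided : ∀ (A : Finset (Site 2)) {u v : Site 2} (r : (zdGraph 2).Walk u v) (J : (zdGraph 2).Walk u u), r.IsPath → 2 ≤ r.length → (∀ x ∈ A, ∀ y ∈ A, ∃ w : (zdGraph 2).Walk x y, ∀ z ∈ w.support, z ∈ A) → (∀ z ∈ J.support, z ∉ A) → (∀ m, m < r.length → J.edges.count s(r.getVert m, r.getVert (m + 1)) = 1) → (∀ m, 0 < m → m < r.length → ∀ e ∈ J.edges, r.getVert m ∈ e → e = s(r.getVert (m - 1), r.getVert m) ∨ e = s(r.getVert m, r.getVert (m + 1))) → (∀ (f : Site 2) (d : ODir) (m : ℕ), f ∈ A → 0 < m → m < r.length → r.getVert m = f + d.vec → (r.getVert (m + 1) = r.getVert m + d.ccw.vec ∨ r.getVert (m - 1)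 = r.getVert m - d.ccw.vec)) ∨ (∀ (f : Site 2) (d : ODir) (m : ℕ), f ∈ A → 0 < m → m < r.length → r.getVert m = f + d.vec → (r.getVert (m + 1) = r.getVert m - d.ccw.vec ∨ r.getVert (m - 1) = r.getVert m + d.ccw.vec)) := by
  intro A u v r J hr hL hA hJA hcount hJr
  -- the vertices of `r` lie on `J`, hence off `A`
  have hrA : ∀ k, k ≤ r.length → r.getVert k ∉ A := by
    intro k hk
    refine hJA _ ?_
    rcases Nat.lt_or_ge k r.length with hlt | hge
    · exact J.fst_mem_support_of_mem_edges (List.count_pos_iff.1 (by rw [hcount k hlt]; exact one_pos))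
    · obtain ⟨k', rfl⟩ : ∃ k', k = k' + 1 := ⟨k - 1, by omega⟩
      exact J.snd_mem_support_of_mem_edges
        (List.count_pos_iff.1 (by rw [hcount k' (by omega)]; exact one_pos))
  -- the first edge: the two values `wL ≠ wR`
  obtain ⟨d₀, hd₀⟩ := ODir.exists_eq_add_vec_of_adj (r.adj_getVert_succ (i := 0) (by omega))
  have hne : walkWinding J (cornerFace (r.getVert 0, d₀.ccw)) ≠ walkWinding J (cornerFace (r.getVert 0, d₀)) :=
    fun h => oneSided_jump (p := J) (r.getVert 0) d₀ (by rw [← hd₀]; exact hcount 0 (by omega)) h.symm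
  have hchain := oneSided_chain r J hr hJr hd₀
  -- all faces at sites of `A` carry one value
  have hAval : ∀ f ∈ A, ∀ f' ∈ A, walkWinding J (f - 1) = walkWinding J (f' - 1) := by
    intro f hf f' hf'
    have hfJ : f ∉ J.support := fun h => hJA f h hf
    have hfJ' : f' ∉ J.support := fun h => hJA f' h hf'
    obtain ⟨w, hw⟩ := hA f hf f' hf'
    have h1 := walkWinding_eq_of_mem_corners J hfJ (oneSided_add_one_mem_corners f)
    have h2 := walkWinding_eq_of_mem_corners J hfJ' (oneSided_add_one_mem_corners f')
    rw [add_sub_cancel_right] at h1 h2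
    rw [← h1, ← h2]
    exact walkWinding_eq_of_walk_closed J w fun z hz hzJ => hJA z hzJ (hw z hz)
  -- one contact
  have key : ∀ (f : Site 2) (d : ODir) (m : ℕ), f ∈ A → 0 < m → m < r.length → r.getVert m = f + d.vec →
      ((r.getVert (m + 1) = r.getVert m + d.ccw.vec ∨ r.getVert (m - 1) = r.getVert m - d.ccw.vec) ∨
        (r.getVert (m + 1) = r.getVert m - d.ccw.vec ∨ r.getVert (m - 1) = r.getVert m + d.ccw.vec)) ∧
      ((r.getVert (m + 1) = r.getVert m + d.ccw.vec ∨ r.getVert (m - 1) = r.getVert m - d.ccw.vec) →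
        walkWinding J (f - 1) = walkWinding J (cornerFace (r.getVert 0, d₀.ccw))) ∧
      ((r.getVert (m + 1) = r.getVert m - d.ccw.vec ∨ r.getVert (m - 1) = r.getVert m + d.ccw.vec) →
        walkWinding J (f - 1) = walkWinding J (cornerFace (r.getVert 0, d₀))) := by
    intro f d m hf hm0 hmL hx
    obtain ⟨b, hb⟩ := ODir.exists_eq_add_vec_of_adj (r.adj_getVert_succ hmL)
    have hadj : (zdGraph 2).Adj (r.getVert (m - 1)) (r.getVert m) := by
      have := r.adj_getVert_succ (i := m - 1) (by omega)
      rwa [Nat.sub_add_cancel hm0] at this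
    obtain ⟨a, ha⟩ := ODir.exists_eq_add_vec_of_adj hadj.symm
    have hab : a ≠ b := by
      intro h
      have h2 : r.getVert (m - 1) = r.getVert (m + 1) := by rw [ha, hb, h]
      have := hr.getVert_injOn (by simp only [Set.mem_setOf_eq]; omega)
        (by simp only [Set.mem_setOf_eq]; omega) h2
      omega
    obtain ⟨hwL, hwR⟩ := hchain m hmL b hb
    exact oneSided_contact (fun h => hJA f h hf) hx ha hb hab
      (fun h => hrA (m - 1) (by omega) (h ▸ hf)) (fun h => hrA (m + 1) (by omega) (h ▸ hf))
      (hJr m hm0 hmL) hwL hwR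
  -- assemble
  rcases Classical.em (∃ (f : Site 2) (d : ODir) (m : ℕ), f ∈ A ∧ 0 < m ∧ m < r.length ∧
      r.getVert m = f + d.vec ∧
      (r.getVert (m + 1) = r.getVert m - d.ccw.vec ∨ r.getVert (m - 1) = r.getVert m + d.ccw.vec))
    with ⟨f', d', m', hf', hm0', hmL', hx', hR'⟩ | hex
  · have hwR : walkWinding J (f' - 1) = walkWinding J (cornerFace (r.getVert 0, d₀)) :=
      (key f' d' m' hf' hm0' hmL' hx').2.2 hR'
    refine Or.inr fun f d m hf hm0 hmL hx => ?_
    obtain ⟨hexh, hl, -⟩ := key f d m hf hm0 hmL hx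
    refine hexh.resolve_left fun hleft => hne ?_
    rw [← hl hleft, ← hwR]
    exact hAval f hf f' hf'
  · refine Or.inl fun f d m hf hm0 hmL hx => ?_
    obtain ⟨hexh, -, -⟩ := key f d m hf hm0 hmL hx
    exact hexh.resolve_right fun hright => hex ⟨f, d, m, hf, hm0, hmL, hx, hright⟩

end Summit.CriticalPhenomena.SAWScalingLimit.Theorems.FKGToTraversalBound.SlitNecklace

end
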